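import Literature.AlgebraicGeometry.ComplexMultiplication.AndreRiemannDecomposition
import Literature.AlgebraicGeometry.ComplexMultiplication.AndreWeakFormOfDomination
import Literature.AlgebraicGeometry.HodgeTheory.AbelianVarietyHodgeFullnessHolds
import HarnessLib

/-!
# André 1992 in the weak record form, II: the record `HodgeTheory.Andre1992_hodgeClasses_cmAbelianVariety_mem_span_pullback_weilClasses`
# HOLDS (modulo Riemann's theorem alone, then unconditionally)

Part 1 (`AndreWeakFormOfRiemann`, §§1–2): the weak André record from Riemann's theorem `DeligneMilne1982_Thm_6_20_full` ALONE
(`andre1992_weak_of_riemann`: «we may suppose `A` is a product over one Galois CM field» is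
`AndreRiemann.exists_avDominatedBy_biproduct_realisations_of_riemann'`, the rest is `andre1992_weak_of_domination`), and the
sharper CM-field-only form (`andre1992_weakField_of_domination`, `andre1992_weakField_of_riemann`: the imaginary-quadratic
member of the record is never needed, the common Galois CM field having degree `> 2`).
Part 2 (`AndreWeakFormHolds`): fed with the tree's proof of Riemann's theorem (`deligneMilne1982_Thm_6_20_full_holds`):
**`HodgeTheory.Andre1992_hodgeClasses_cmAbelianVariety_mem_span_pullback_weilClasses_holds`** (EXACT name; the record stays a
`def`, its users' binders are fed this theorem) and `andre1992_weakField_holds`.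

André 1992 Théorème = Charles–Schnell 2014 Thm. 11.5.21 = Milne's endnote M.12 to Deligne 1982: every rational `(k,k)` class on
a complex abelian variety carrying a commutative reduced `S ⊆ End⁰(A)` with `dim_ℚ S = 2 dim A` is a `ℂ`-combination of
pull-backs of rational `(k,k)` Weil classes. No case of the Hodge conjecture is proved; the conditional reductions of the
Hodge conjecture for CM abelian varieties of the Summits-side file (§3 there) are not re-homed.

Provenance: Literature home (namespace `Literature.AlgebraicGeometry.ComplexMultiplication.AndreWeakForm`) of §§1–2 of the
Summits-side `CorCM/AndreWeakFormOfRiemann` and of `CorCM/AndreWeakFormHolds` (imports `Literature/` and Mathlib only). Lane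
`lit-hodgefound` (Layer A3/A4), seat p20.

## References
* [Andre1992HodgeCM] Y. André, *Une remarque à propos des cycles de Hodge de type CM* (1992), Théorème (pp. 4–5).
* [CharlesSchnell2014Notes] F. Charles, C. Schnell, *Notes on absolute Hodge classes* (2014), Thm. 11.5.21 and proof (pp. 510–511).
* [Deligne1982HodgeCycles] P. Deligne (notes by J. S. Milne), LNM 900 (1982), §5 and endnote M.12 (p. 64).
* [DeligneMilne1982Tannakian] P. Deligne, J. S. Milne, *Tannakian categories*, LNM 900 (1982), §6 Thm. 6.20 (p. 212).
* [Milne2020HodgeClassesAV] J. S. Milne, *Hodge classes on abelian varieties* (2020), §3 Thm. 1 and proof.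
-/

noncomputable section

namespace Literature.AlgebraicGeometry.ComplexMultiplication.AndreWeakForm

/-! ## Part 1: the weak record modulo Riemann's theorem alone; the CM-field-only form -/

section Part1

open _root_.CategoryTheory _root_.CategoryTheory.Limits NumberField Polynomial
open Literature.AlgebraicGeometry Literature.AlgebraicGeometry.Motives Literature.AlgebraicGeometry.HodgeTheory
open Literature.AlgebraicGeometry.ComplexMultiplication Literature.AlgebraicGeometry.Milne1999
open Literature.NumberTheory.Automorphic.PicardCM (eigenline)
open Literature.AlgebraicGeometry.ComplexMultiplication.Domination
open Literature.AlgebraicGeometry.ComplexMultiplication.AndreProductForm Literature.AlgebraicGeometry.ComplexMultiplication.Milne2020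

/-! ## §1 The weak André record from Riemann's theorem alone -/

/-- **André 1992 (weak record form) for EVERY complex abelian variety of CM type, modulo Riemann's theorem
ONLY.** The Literature record `HodgeTheory.Andre1992_hodgeClasses_cmAbelianVariety_mem_span_pullback_weilClasses`
— every rational `(k,k)` class on a complex abelian variety with a commutative reduced `S ⊆ End⁰(A)` of
dimension `2 dim A` is a `ℂ`-combination of pull-backs of rational `(k,k)` Weil classes of imaginary
quadratic fields (`weilClassesOf`) or of CM fields of degree `e > 2` (`weilClassesField`) — follows from
`DeligneMilne1982_Thm_6_20_full` (fullness of `H¹_B`, Deligne–Milne Thm. 6.20): «we may suppose `A` is a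
product over one Galois CM field» is
`AndreRiemann.exists_avDominatedBy_biproduct_realisations_of_riemann'` (no `hU`, no `h₃`), the rest is
the record-free assembly `andre1992_weak_of_domination`.
[cite: Andre1992HodgeCM, Théorème (pp. 4–5)] [cite: CharlesSchnell2014Notes, Thm. 11.5.21 and proof (pp. 510–511)]
[cite: Deligne1982HodgeCycles, §5 and endnote M.12 (p. 64)] [cite: DeligneMilne1982Tannakian, §6 Thm. 6.20 (Riemann), p. 212] -/
theorem andre1992_weak_of_riemann (hR : DeligneMilne1982_Thm_6_20_full) :
    Andre1992_hodgeClasses_cmAbelianVariety_mem_span_pullback_weilClasses :=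
  andre1992_weak_of_domination (AndreRiemann.exists_avDominatedBy_biproduct_realisations_of_riemann' hR)

/-! ## §2 The sharper form: CM fields of degree `> 2` only -/

section FieldOnly

variable (K : Type) [Field K] [NumberField K] [IsCMField K] [IsGalois ℚ K]

/-- **Product case, CM-field member only.** On `⨁_{i<n} A_i`, `(A_i, ι_i, θ_i)` realising CM types of the
Galois CM field `K` with `2 < [K:ℚ]`, every rational `(k,k)` class lies in the span of the SECOND member of
the weak record's target family alone (pull-backs of rational `(k,k)` classes of `weilClassesField B ψ P (2k)`,
`ℚ(ψ) ≅ ℚ[T]/(P)` CM of degree `e > 2`, `e · 2k = 2 dim B`): the witnesses of `andreWeak_cmTypedProduct`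
(`B_Δ`, `f_Δ`, `ψ = act(a₀)`, `P = minpoly a₀`, `e = [K:ℚ]`, `t_Δ`) all land there.
[cite: CharlesSchnell2014Notes, Thm. 11.5.21 and proof (pp. 510–511)] [cite: Milne2020HodgeClassesAV, §3 Thm. 1 and proof] -/
theorem andreWeakField_cmTypedProduct (hK : 2 < Module.finrank ℚ K) {n : ℕ} (A : Fin n → AbelianVariety ℂ)
    (Φ : Fin n → CMType K) (ι : ∀ i, 𝓞 K →+* End (A i))
    (θ : ∀ i, K →+* Module.End ℂ (complexBetti (A i).X 1))
    (hA : ∀ i, IsCMTypeRealisation (Φ i) (A i) (ι i) (θ i)) (k : ℕ)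
    (c : complexBetti (⨁ A).X (2 * k)) (hcQ : IsRationalClass c)
    (hcH : IsOfHodgeType (⨁ A).dim (⨁ A).X (2 * k) k k c) :
    c ∈ Submodule.span ℂ
        {c' : complexBetti (⨁ A).X (2 * k) |
            ∃ (B : Motives.AbelianVariety ℂ) (g : (⨁ A).X ⟶ B.X) (ψ : B ⟶ B) (P : Polynomial ℤ) (e : ℕ)
              (w : complexBetti B.X (2 * k)),
              P.Monic ∧ P.natDegree = e ∧ 2 < e ∧ Irreducible (P.map (Int.castRingHom ℚ)) ∧
                Polynomial.eval₂ (Int.castRingHom (CategoryTheory.End B)) (ψ : CategoryTheory.End B) P = 0 ∧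
                e * (2 * k) = 2 * B.dim ∧
                (∀ ρ : ℂ, Polynomial.eval₂ (Int.castRingHom ℂ) ρ P = 0 → starRingEnd ℂ ρ ≠ ρ) ∧
                (∃ Q : Polynomial ℚ, ∀ ρ : ℂ, Polynomial.eval₂ (Int.castRingHom ℂ) ρ P = 0 →
                    Polynomial.eval₂ (algebraMap ℚ ℂ) ρ Q = starRingEnd ℂ ρ) ∧
                w ∈ weilClassesField B ψ P (2 * k) ∧ IsRationalClass w ∧
                IsOfHodgeType B.dim B.X (2 * k) k k w ∧ c' = complexBetti.map g (2 * k) w} := by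
  classical
  have h := Andre1992_hodgeClasses_cmTypedProduct_mem_span_pullback_weilLines_holds K n A Φ ι θ hA k c
    hcQ hcH
  refine Submodule.span_mono ?_ h
  rintro _ ⟨i, e, t, -, -, htQ, htH, htW, rfl⟩
  obtain ⟨a₀, hsep⟩ := exists_integer_separating K
  obtain ⟨hPm, hPe, -, hPirr, hreal, hQ, -⟩ := isGaloisCMFieldPoly_minpoly K a₀ hsep
  let Bs : Fin (2 * k) → AbelianVariety ℂ := fun j => A (i j)
  let act : ∀ j, 𝓞 K →+* End (Bs j) :=
    fun j => (ι (i j)).comp (RingOfIntegers.mapRingEquiv (e j).symm).toRingHom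
  have hv : ∀ i₀ : Fin n, ∃ v : Module.Basis (K →+* ℂ) ℂ (complexBetti (A i₀).X 1),
      ∀ σ, v σ ∈ eigenline (θ i₀) σ := fun i₀ => exists_eigenbasis (hA i₀)
  choose v hv using hv
  have hdim : Module.finrank ℚ K * (2 * k) = 2 * (⨁ Bs).dim := by
    rw [two_mul_dim_biproduct Bs (fun j => v (i j)), Fintype.card_fin, ← NumberField.Embeddings.card K ℂ,
      mul_comm]
  exact ⟨⨁ Bs, (multiDiagonal A i).hom.hom.hom, diagHom K Bs act a₀, minpoly ℤ a₀, Module.finrank ℚ K, t,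
    hPm, hPe, hK, hPirr, eval₂_diagHom_minpoly K Bs act a₀, hdim, hreal, hQ,
    weilLineClasses_le_weilClassesField K Bs act a₀ (2 * k) htW, htQ, htH, rfl⟩

end FieldOnly

/-- The CM-field member of the weak record's target family is stable under further pull-back along any
`ℂ`-morphism `X.X ⟶ Y.X` (`(g ≫ g')^* w = g^* g'^* w`). [cite: CharlesSchnell2014Notes, Thm. 11.5.21 (p. 510)] -/
theorem weakFieldTargets_pullback_stable (k : ℕ) (X Y : AbelianVariety ℂ) (g : X.X ⟶ Y.X)
    (w : complexBetti Y.X (2 * k))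
    (hw : w ∈
       {c' : complexBetti Y.X (2 * k) |
          ∃ (B : Motives.AbelianVariety ℂ) (g : Y.X ⟶ B.X) (ψ : B ⟶ B) (P : Polynomial ℤ) (e : ℕ)
            (w : complexBetti B.X (2 * k)),
            P.Monic ∧ P.natDegree = e ∧ 2 < e ∧ Irreducible (P.map (Int.castRingHom ℚ)) ∧
              Polynomial.eval₂ (Int.castRingHom (CategoryTheory.End B)) (ψ : CategoryTheory.End B) P = 0 ∧
              e * (2 * k) = 2 * B.dim ∧
              (∀ ρ : ℂ, Polynomial.eval₂ (Int.castRingHom ℂ) ρ P = 0 → starRingEnd ℂ ρ ≠ ρ) ∧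
              (∃ Q : Polynomial ℚ, ∀ ρ : ℂ, Polynomial.eval₂ (Int.castRingHom ℂ) ρ P = 0 →
                  Polynomial.eval₂ (algebraMap ℚ ℂ) ρ Q = starRingEnd ℂ ρ) ∧
              w ∈ weilClassesField B ψ P (2 * k) ∧ IsRationalClass w ∧
              IsOfHodgeType B.dim B.X (2 * k) k k w ∧ c' = complexBetti.map g (2 * k) w}) :
    complexBetti.map g (2 * k) w ∈
       {c' : complexBetti X.X (2 * k) |
          ∃ (B : Motives.AbelianVariety ℂ) (g : X.X ⟶ B.X) (ψ : B ⟶ B) (P : Polynomial ℤ) (e : ℕ)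
            (w : complexBetti B.X (2 * k)),
            P.Monic ∧ P.natDegree = e ∧ 2 < e ∧ Irreducible (P.map (Int.castRingHom ℚ)) ∧
              Polynomial.eval₂ (Int.castRingHom (CategoryTheory.End B)) (ψ : CategoryTheory.End B) P = 0 ∧
              e * (2 * k) = 2 * B.dim ∧
              (∀ ρ : ℂ, Polynomial.eval₂ (Int.castRingHom ℂ) ρ P = 0 → starRingEnd ℂ ρ ≠ ρ) ∧
              (∃ Q : Polynomial ℚ, ∀ ρ : ℂ, Polynomial.eval₂ (Int.castRingHom ℂ) ρ P = 0 →
                  Polynomial.eval₂ (algebraMap ℚ ℂ) ρ Q = starRingEnd ℂ ρ) ∧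
              w ∈ weilClassesField B ψ P (2 * k) ∧ IsRationalClass w ∧
              IsOfHodgeType B.dim B.X (2 * k) k k w ∧ c' = complexBetti.map g (2 * k) w} := by
  rcases hw with ⟨B, g', ψ, P, e, w', h1, h2, h3, h4, h5, h6, h7, h8, h9, h10, h11, rfl⟩
  exact ⟨B, g ≫ g', ψ, P, e, w', h1, h2, h3, h4, h5, h6, h7, h8, h9, h10, h11,
    by rw [complexBetti.map_comp, ModuleCat.comp_apply]⟩

/-- **CM-field-only form over an abstract domination hypothesis**: if every complex abelian variety of CM
type is dominated by a finite biproduct of realisations of CM types of one Galois CM field of degree `> 2`,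
then every rational `(k,k)` class on it lies in the span of pull-backs of rational `(k,k)` Weil classes of
CM fields of degree `e > 2` (`weilClassesField`, `e · 2k = 2 dim B`). Product case
`andreWeakField_cmTypedProduct`, descent `mem_span_of_retraction`.
[cite: CharlesSchnell2014Notes, Thm. 11.5.21 and proof (pp. 510–511)] [cite: Milne2020HodgeClassesAV, §3 Thm. 1 and proof] -/
theorem andre1992_weakField_of_domination
    (hdom : ∀ A : AbelianVariety ℂ, IsOfCMType A →
      ∃ (F : Type) (_ : Field F) (_ : NumberField F) (_ : IsCMField F),
        IsGalois ℚ F ∧ 2 < Module.finrank ℚ F ∧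
          ∃ (n : ℕ) (B : Fin n → AbelianVariety ℂ) (Φ : Fin n → CMType F)
            (ι : ∀ i, 𝓞 F →+* End (B i)) (θ : ∀ i, F →+* Module.End ℂ (complexBetti (B i).X 1)),
            (∀ i, IsCMTypeRealisation (Φ i) (B i) (ι i) (θ i)) ∧ AVDominatedBy A (⨁ B))
    (A : AbelianVariety ℂ) (hCM : IsOfCMType A) (k : ℕ) (c : complexBetti A.X (2 * k))
    (hcQ : IsRationalClass c) (hcH : IsOfHodgeType A.dim A.X (2 * k) k k c) :
    c ∈ Submodule.span ℂ
       {c' : complexBetti A.X (2 * k) |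
          ∃ (B : Motives.AbelianVariety ℂ) (g : A.X ⟶ B.X) (ψ : B ⟶ B) (P : Polynomial ℤ) (e : ℕ)
            (w : complexBetti B.X (2 * k)),
            P.Monic ∧ P.natDegree = e ∧ 2 < e ∧ Irreducible (P.map (Int.castRingHom ℚ)) ∧
              Polynomial.eval₂ (Int.castRingHom (CategoryTheory.End B)) (ψ : CategoryTheory.End B) P = 0 ∧
              e * (2 * k) = 2 * B.dim ∧
              (∀ ρ : ℂ, Polynomial.eval₂ (Int.castRingHom ℂ) ρ P = 0 → starRingEnd ℂ ρ ≠ ρ) ∧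
              (∃ Q : Polynomial ℚ, ∀ ρ : ℂ, Polynomial.eval₂ (Int.castRingHom ℂ) ρ P = 0 →
                  Polynomial.eval₂ (algebraMap ℚ ℂ) ρ Q = starRingEnd ℂ ρ) ∧
              w ∈ weilClassesField B ψ P (2 * k) ∧ IsRationalClass w ∧
              IsOfHodgeType B.dim B.X (2 * k) k k w ∧ c' = complexBetti.map g (2 * k) w} := by
  classical
  obtain ⟨F, _instF, _instNF, _instCM, hGal, hF, n, B, Φ, ι, θ, hB, s, π, N, hN, hsπ⟩ := hdom A hCM
  haveI : IsGalois ℚ F := hGal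
  exact mem_span_of_retraction (k := k)
    (fun X : AbelianVariety ℂ =>
       {c' : complexBetti X.X (2 * k) |
          ∃ (B : Motives.AbelianVariety ℂ) (g : X.X ⟶ B.X) (ψ : B ⟶ B) (P : Polynomial ℤ) (e : ℕ)
            (w : complexBetti B.X (2 * k)),
            P.Monic ∧ P.natDegree = e ∧ 2 < e ∧ Irreducible (P.map (Int.castRingHom ℚ)) ∧
              Polynomial.eval₂ (Int.castRingHom (CategoryTheory.End B)) (ψ : CategoryTheory.End B) P = 0 ∧
              e * (2 * k) = 2 * B.dim ∧
              (∀ ρ : ℂ, Polynomial.eval₂ (Int.castRingHom ℂ) ρ P = 0 → starRingEnd ℂ ρ ≠ ρ) ∧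
              (∃ Q : Polynomial ℚ, ∀ ρ : ℂ, Polynomial.eval₂ (Int.castRingHom ℂ) ρ P = 0 →
                  Polynomial.eval₂ (algebraMap ℚ ℂ) ρ Q = starRingEnd ℂ ρ) ∧
              w ∈ weilClassesField B ψ P (2 * k) ∧ IsRationalClass w ∧
              IsOfHodgeType B.dim B.X (2 * k) k k w ∧ c' = complexBetti.map g (2 * k) w})
    (weakFieldTargets_pullback_stable k) s π hN hsπ
    (fun c' hc'Q hc'H => andreWeakField_cmTypedProduct F hF B Φ ι θ hB k c' hc'Q hc'H) c hcQ hcH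

/-- **André's theorem, CM-field-only form, modulo Riemann's theorem**: every rational `(k,k)` class on a
complex abelian variety of CM type is a `ℂ`-combination of pull-backs `g^*(w)` of rational `(k,k)` classes
`w ∈ weilClassesField B ψ P (2k)`, `ℚ(ψ) ≅ ℚ[T]/(P)` a CM field of degree `e > 2`, `e · 2k = 2 dim B`
(the imaginary-quadratic member of the record is never needed: the common Galois CM field of b24's
domination has degree `> 2`). [cite: Andre1992HodgeCM, Théorème (pp. 4–5)]
[cite: CharlesSchnell2014Notes, Thm. 11.5.21 and proof (pp. 510–511)] [cite: DeligneMilne1982Tannakian, §6 Thm. 6.20 (Riemann)] -/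
theorem andre1992_weakField_of_riemann (hR : DeligneMilne1982_Thm_6_20_full)
    (A : AbelianVariety ℂ) (hCM : IsOfCMType A) (k : ℕ) (c : complexBetti A.X (2 * k))
    (hcQ : IsRationalClass c) (hcH : IsOfHodgeType A.dim A.X (2 * k) k k c) :
    c ∈ Submodule.span ℂ
       {c' : complexBetti A.X (2 * k) |
          ∃ (B : Motives.AbelianVariety ℂ) (g : A.X ⟶ B.X) (ψ : B ⟶ B) (P : Polynomial ℤ) (e : ℕ)
            (w : complexBetti B.X (2 * k)),
            P.Monic ∧ P.natDegree = e ∧ 2 < e ∧ Irreducible (P.map (Int.castRingHom ℚ)) ∧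
              Polynomial.eval₂ (Int.castRingHom (CategoryTheory.End B)) (ψ : CategoryTheory.End B) P = 0 ∧
              e * (2 * k) = 2 * B.dim ∧
              (∀ ρ : ℂ, Polynomial.eval₂ (Int.castRingHom ℂ) ρ P = 0 → starRingEnd ℂ ρ ≠ ρ) ∧
              (∃ Q : Polynomial ℚ, ∀ ρ : ℂ, Polynomial.eval₂ (Int.castRingHom ℂ) ρ P = 0 →
                  Polynomial.eval₂ (algebraMap ℚ ℂ) ρ Q = starRingEnd ℂ ρ) ∧
              w ∈ weilClassesField B ψ P (2 * k) ∧ IsRationalClass w ∧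
              IsOfHodgeType B.dim B.X (2 * k) k k w ∧ c' = complexBetti.map g (2 * k) w} :=
  andre1992_weakField_of_domination (AndreRiemann.exists_avDominatedBy_biproduct_realisations_of_riemann' hR)
    A hCM k c hcQ hcH

end Part1

/-! ## Part 2: the record HOLDS -/

section Part2

open _root_.CategoryTheory
open Literature.AlgebraicGeometry Literature.AlgebraicGeometry.Motives Literature.AlgebraicGeometry.HodgeTheory
open Literature.AlgebraicGeometry.Milne1999

/-- **André 1992 (= Charles–Schnell 2014 Thm. 11.5.21 = Milne's endnote M.12 to Deligne 1982), the tree's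
record, UNCONDITIONALLY: every rational `(k,k)` class on a complex abelian variety `A` carrying a commutative
reduced `S ⊆ End⁰(A)` with `dim_ℚ S = 2 dim A` is a `ℂ`-combination of pull-backs `g^*(w)` (`g : A.X ⟶ B.X`)
of rational `(k,k)` Weil classes — of `weilClassesOf B ψ k d` (`ψ² = -d`, imaginary quadratic `E`) or of
`weilClassesField B ψ P (2k)` (`ℚ(ψ) ≅ ℚ[T]/(P)` a CM field of degree `e > 2`, `e · 2k = 2 dim B`).**
André's theorem from Riemann's theorem (`andre1992_weak_of_riemann`) fed with the tree's proof of Riemann's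
theorem (`deligneMilne1982_Thm_6_20_full_holds`).  DISCHARGES the Literature record
`HodgeTheory.Andre1992_hodgeClasses_cmAbelianVariety_mem_span_pullback_weilClasses`.
[cite: Andre1992HodgeCM, Théorème (pp. 4–5)] [cite: Deligne1982HodgeCycles, endnote M.12 (p. 64)]
[cite: CharlesSchnell2014Notes, Thm. 11.5.21 and proof (pp. 510–511)]
[cite: DeligneMilne1982Tannakian, §6 Thm. 6.20 (Riemann), p. 212] -/
theorem _root_.Literature.AlgebraicGeometry.HodgeTheory.Andre1992_hodgeClasses_cmAbelianVariety_mem_span_pullback_weilClasses_holds :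
    Andre1992_hodgeClasses_cmAbelianVariety_mem_span_pullback_weilClasses :=
  andre1992_weak_of_riemann deligneMilne1982_Thm_6_20_full_holds

/-- **André's theorem, CM-field-only form, UNCONDITIONALLY**: every rational `(k,k)` class on a complex abelian
variety of CM type (`Milne1999.IsOfCMType`) is a `ℂ`-combination of pull-backs `g^*(w)` of rational `(k,k)`
classes `w ∈ weilClassesField B ψ P (2k)`, `ℚ(ψ) ≅ ℚ[T]/(P)` a CM field of degree `e > 2`,
`e · 2k = 2 dim B` — the imaginary-quadratic member of the record is never needed (the common Galois CM field
of the domination has degree `> 2`).  `andre1992_weakField_of_riemann` at `deligneMilne1982_Thm_6_20_full_holds`.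
[cite: Andre1992HodgeCM, Théorème (pp. 4–5)] [cite: Deligne1982HodgeCycles, endnote M.12 (p. 64)]
[cite: DeligneMilne1982Tannakian, §6 Thm. 6.20 (Riemann), p. 212] -/
theorem andre1992_weakField_holds (A : AbelianVariety ℂ) (hCM : IsOfCMType A) (k : ℕ)
    (c : complexBetti A.X (2 * k)) (hcQ : IsRationalClass c)
    (hcH : IsOfHodgeType A.dim A.X (2 * k) k k c) :
    c ∈ Submodule.span ℂ
       {c' : complexBetti A.X (2 * k) |
          ∃ (B : Motives.AbelianVariety ℂ) (g : A.X ⟶ B.X) (ψ : B ⟶ B) (P : Polynomial ℤ) (e : ℕ)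
            (w : complexBetti B.X (2 * k)),
            P.Monic ∧ P.natDegree = e ∧ 2 < e ∧ Irreducible (P.map (Int.castRingHom ℚ)) ∧
              Polynomial.eval₂ (Int.castRingHom (CategoryTheory.End B)) (ψ : CategoryTheory.End B) P = 0 ∧
              e * (2 * k) = 2 * B.dim ∧
              (∀ ρ : ℂ, Polynomial.eval₂ (Int.castRingHom ℂ) ρ P = 0 → starRingEnd ℂ ρ ≠ ρ) ∧
              (∃ Q : Polynomial ℚ, ∀ ρ : ℂ, Polynomial.eval₂ (Int.castRingHom ℂ) ρ P = 0 →
                  Polynomial.eval₂ (algebraMap ℚ ℂ) ρ Q = starRingEnd ℂ ρ) ∧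
              w ∈ weilClassesField B ψ P (2 * k) ∧ IsRationalClass w ∧
              IsOfHodgeType B.dim B.X (2 * k) k k w ∧ c' = complexBetti.map g (2 * k) w} :=
  andre1992_weakField_of_riemann deligneMilne1982_Thm_6_20_full_holds A hCM k c hcQ hcH

end Part2

end Literature.AlgebraicGeometry.ComplexMultiplication.AndreWeakForm

end
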